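import Mathlib.RingTheory.PowerSeries.Basic
import Mathlib.Analysis.Normed.Ring.InfiniteSum
import Mathlib.Analysis.Asymptotics.SpecificAsymptotics
import Mathlib.NumberTheory.FrobeniusNumber
import Mathlib.Tactic.NoncommRing
import Literature.Probability.Process.RenewalTheoremAperiodic
import Literature.Probability.Process.RenewalTheoremGeneral
import Literature.Analysis.Asymptotics.KaramataPowerSeries
import HarnessLib

/-!
# The coefficient renewal theorem for matrix renewal sequences (finite state space, critical point)

Topic `Literature/Probability/Process` (renewal theory; continues `RenewalTheoremAperiodic.lean` — the Erdős–Feller–Pollard theorem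
`Renewal.tendsto_of_summable_mul_of_setGcd` — and `RenewalTheoremGeneral.lean` — Madras–Slade's Theorem 4.2.2 (b) with a delay,
`Renewal.tendsto_sum_antidiagonal_mul`).  Lane «pcv-sawmu» (CriticalPhenomena venture), a-p2 g19.

THE SETTING.  A finite index set `ι` ("levels") and two sequences of non-negative `ι × ι` matrices `M(j)`, `D(m)` (`j, m ≥ 0`)
tied by the MATRIX RENEWAL EQUATION `D(m) = M(m) + Σ_{i+j=m} M(i) · D(j)` — in generating-function language `D = I + I·D`,
`I(s) = Σ_j M(j) s^j`, `D(s) = Σ_m D(m) s^m`, i.e. `1 + D = Σ_{k≥0} I^k`: `D(m)_{ab}` is the total weight of the finite sequences of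
"pieces" `a = c₀ → c₁ → ⋯ → c_k = b` (`k ≥ 1`) whose piece weights `M(j)_{c_{i-1} c_i}` carry "lengths" `j` adding up to `m`
(a Markov renewal / semi-Markov structure in discrete time).  CRITICALITY is expressed by the ABELIAN hypothesis
`(1 − s) · Σ_m D(m)_{ab} s^m → L_{ab} > 0` (`s ↑ 1`) for all `a, b`, FINITE MEAN by `Σ_j j · M(j)_{ab} < ∞`, and APERIODICITY by
`gcd {m : D(m)_{oo} > 0} = 1` at one level `o`.

THE THEOREM (`RenewalKernelPair.tendsto_coeff`).  Under these hypotheses the coefficients converge POINTWISE: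
`D(m)_{ab} → L_{ab}` as `m → ∞`, for all `a, b`; and (`Critical.eq_inv_tsum_mul_phi`) on the diagonal `L_{ee} = 1/Σ_m m φ_e(m)` — the
reciprocal of the mean length of a first return to `e` (Feller's `u_n → 1/μ`).

THE PROOF (the lane's; classical ingredients).  (1) Power-series algebra over the matrix ring (`PowerSeries (Matrix ι ι ℝ)`):
`G := 1 + D = 1 + I·G = Σ_{k<n} I^k + I^n G`, whence `G(m) = Σ_k [s^m] I^k` (§1) and the positivity semigroup
`[s^m] I^k > 0` (§2).  (2) TABOO at a level `e` (§3): `J :=` `I` with the column `e` deleted, `N := Σ_k J^k = 1 + N·J`, and the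
resolvent identity `G − N = N (I − J) G`; read in the column `e` it is the FIRST-PASSAGE DECOMPOSITION
`G(m)_{ce} = δ_{ce}δ_{m0} + Σ_{i+j=m} φ_c(i) u(j)` with `u(m) = G(m)_{ee}` and the non-negative first-passage coefficients
`φ_c(i) = [s^i](N·I)_{ce}` (Chung's taboo probabilities / Feller's recurrent events, for weights instead of probabilities).
(3) Generating functions on `[0,1)` (§4): `û(1 − φ̂_e) = 1`; the Abelian hypothesis forces `φ̂_e(s) → 1`, hence `Σ_m φ_e(m) = 1`
(recurrence), `Σ_m φ_c(m) = L_{ce}/L_{ee}`, and `Σ_m m φ_e(m) ≤ 1/L_{ee} < ∞` (positive recurrence) — by monotone convergence only.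
(4) Aperiodicity TRANSFERS from `o` to every level through the positivity semigroup and irreducibility (itself a consequence of
`L > 0`), and from the renewal sequence `u` to the first-return law (§6).  (5) After normalising away the zero-length returns
(`φ_e(0) > 0` is allowed: `ṽ = (1 − φ_e(0)) u`, `f̃ = φ_e/(1 − φ_e(0))` off `0`) the tree's Erdős–Feller–Pollard theorem gives
`u(m) → Λ_e`, the delayed version gives `D(m)_{ce} → (L_{ce}/L_{ee}) Λ_e`, and the ABELIAN direction of the Hardy–Littlewood theorem
(tree, `hardyLittlewood_powerSeries_iff`) identifies the limits with `L_{ce}` (§6).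

Sources of the TEMPLATE: W. Feller, *An Introduction to Probability Theory and its Applications* I (3rd ed. 1968) XIII.3–4, XIII.10–11
(recurrent events, the renewal theorem; delayed recurrent events); N. Madras, G. Slade, *The Self-Avoiding Walk* (1993) Theorem 4.2.2 (b)
and Appendix B; E. Seneta, *Non-negative Matrices* (1973) Chapter 6 (R-theory: the critical value of a non-negative kernel).  The
reduction of a finite-state matrix ("Markov") renewal equation at its critical point to the scalar theorem through taboo series, with
ALL inputs expressed through the Abelian limits `L_{ab}`, is the lane's arrangement; used by `RandomPlanarGeometry/HexSAWStripBridge…`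
(self-avoiding bridges of a honeycomb strip at the surface threshold).

Label: LANE THEOREM on a CLASSICAL TEMPLATE (own arrangement; Feller / Erdős–Feller–Pollard / Madras–Slade / taboo decomposition).
NOT claimed: rates of convergence, infinite `ι`, the periodic case, the null-recurrent (`Σ j M(j) = ∞`) case.
-/

noncomputable section

open Finset Filter Topology PowerSeries

namespace Literature.Probability.Process

variable {ι : Type*} [Fintype ι] [DecidableEq ι]

/-- A MATRIX RENEWAL PAIR on the finite level set `ι`: non-negative matrix sequences `M(j)` (the "one-piece" kernel, `j` = length of
the piece) and `D(m)` (all finite sequences of pieces of total length `m`) tied by the matrix renewal equation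
`D(m) = M(m) + Σ_{i+j=m} M(i) D(j)`. [cite: Feller1968, XIII.3 (recurrent events: the renewal equation); MadrasSlade1993, Appendix B (B.1); lane «pcv-sawmu» — matrix form] -/
structure RenewalKernelPair (ι : Type*) [Fintype ι] [DecidableEq ι] where
  /-- the one-piece kernel `M(j)_{ab} ≥ 0` -/
  M : ℕ → Matrix ι ι ℝ
  /-- the all-sequences kernel `D(m)_{ab} ≥ 0` -/
  D : ℕ → Matrix ι ι ℝ
  /-- `M ≥ 0` entrywise -/
  M_nonneg : ∀ j a b, 0 ≤ M j a b
  /-- `D ≥ 0` entrywise -/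
  D_nonneg : ∀ m a b, 0 ≤ D m a b
  /-- the matrix renewal equation `D(m) = M(m) + Σ_{i+j=m} M(i) D(j)` -/
  ren : ∀ m, D m = M m + ∑ p ∈ antidiagonal m, M p.1 * D p.2

namespace RenewalKernelPair

omit [DecidableEq ι] in
/-- Entry `(a,b)` of the `m`-th coefficient of a matrix power series (bookkeeping). [cite: Feller1968, XIII.3; lane plumbing] -/
def cf (m : ℕ) (F : PowerSeries (Matrix ι ι ℝ)) (a b : ι) : ℝ := (coeff m F : Matrix ι ι ℝ) a b

/-- `cf` of a product: `[s^m](F H)_{ab} = Σ_{i+j=m} Σ_c [s^i]F_{ac} [s^j]H_{cb}`. [cite: Feller1968, XIII.3; lane plumbing] -/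
theorem cf_mul (m : ℕ) (F H : PowerSeries (Matrix ι ι ℝ)) (a b : ι) :
    cf m (F * H) a b = ∑ p ∈ antidiagonal m, ∑ c, cf p.1 F a c * cf p.2 H c b := by
  simp only [cf, coeff_mul, Matrix.sum_apply, Matrix.mul_apply]

/-- `cf` of `1`. [cite: Feller1968, XIII.3; lane plumbing] -/
theorem cf_one (m : ℕ) (a b : ι) : cf m (1 : PowerSeries (Matrix ι ι ℝ)) a b = if m = 0 ∧ a = b then 1 else 0 := by
  simp only [cf, coeff_one]
  by_cases hm : m = 0
  · subst hm; by_cases hab : a = b <;> simp [hab, Matrix.one_apply]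
  · simp [hm]

/-- `cf` is additive. [cite: Feller1968, XIII.3; lane plumbing] -/
theorem cf_add (m : ℕ) (F H : PowerSeries (Matrix ι ι ℝ)) (a b : ι) : cf m (F + H) a b = cf m F a b + cf m H a b := by
  simp only [cf, map_add, Matrix.add_apply]

/-- `cf` of a difference. [cite: Feller1968, XIII.3; lane plumbing] -/
theorem cf_sub (m : ℕ) (F H : PowerSeries (Matrix ι ι ℝ)) (a b : ι) : cf m (F - H) a b = cf m F a b - cf m H a b := by
  simp only [cf, map_sub, Matrix.sub_apply]

/-- `cf` of a finite sum. [cite: Feller1968, XIII.3; lane plumbing] -/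
theorem cf_sum {α : Type*} (s : Finset α) (F : α → PowerSeries (Matrix ι ι ℝ)) (m : ℕ) (a b : ι) :
    cf m (∑ x ∈ s, F x) a b = ∑ x ∈ s, cf m (F x) a b := by
  simp only [cf, map_sum, Matrix.sum_apply]

/-- `cf` of `PowerSeries.mk`. [cite: Feller1968, XIII.3; lane plumbing] -/
theorem cf_mk (f : ℕ → Matrix ι ι ℝ) (m : ℕ) (a b : ι) : cf m (PowerSeries.mk f) a b = f m a b := by
  simp only [cf, coeff_mk]

variable (K : RenewalKernelPair ι)

/-! ### §1 Power-series bookkeeping: `G = 1 + D = 1 + I·G = Σ_k I^k` -/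

/-- The one-piece kernel as a power series `I = Σ_j M(j) s^j` over the matrix ring. [cite: Feller1968, XIII.3; lane] -/
def serM : PowerSeries (Matrix ι ι ℝ) := PowerSeries.mk K.M

/-- `G = 1 + Σ_m D(m) s^m`. [cite: Feller1968, XIII.3; lane] -/
def serG : PowerSeries (Matrix ι ι ℝ) := 1 + PowerSeries.mk K.D

/-- `G(m)_{ab} = [m = 0][a = b] + D(m)_{ab}`, the coefficients of `G`. [cite: Feller1968, XIII.3; lane] -/
def G (m : ℕ) (a b : ι) : ℝ := cf m K.serG a b

/-- `[s^m] I = M(m)`. [cite: Feller1968, XIII.3; lane plumbing] -/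
@[simp] theorem coeff_serM (m : ℕ) : coeff m K.serM = K.M m := coeff_mk _ _

/-- `[s^m] I_{ab} = M(m)_{ab}`. [cite: Feller1968, XIII.3; lane plumbing] -/
@[simp] theorem cf_serM (m : ℕ) (a b : ι) : cf m K.serM a b = K.M m a b := cf_mk _ _ _ _

/-- `G(m)_{ab} = [m = 0][a = b] + D(m)_{ab}`. [cite: Feller1968, XIII.3; lane plumbing] -/
theorem G_apply (m : ℕ) (a b : ι) : K.G m a b = (if m = 0 ∧ a = b then 1 else 0) + K.D m a b := by
  rw [G, serG, cf_add, cf_one, cf_mk]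

/-- `G(m)_{ab} = D(m)_{ab}` for `m ≥ 1`. [cite: Feller1968, XIII.3; lane plumbing] -/
theorem G_eq_D {m : ℕ} (hm : m ≠ 0) (a b : ι) : K.G m a b = K.D m a b := by
  rw [G_apply]; simp [hm]

/-- `D(m)_{ab} ≤ G(m)_{ab}`. [cite: Feller1968, XIII.3; lane plumbing] -/
theorem D_le_G (m : ℕ) (a b : ι) : K.D m a b ≤ K.G m a b := by
  rw [G_apply]; split_ifs <;> linarith

/-- `G ≥ 0` entrywise. [cite: Feller1968, XIII.3; lane plumbing] -/
theorem G_nonneg (m : ℕ) (a b : ι) : 0 ≤ K.G m a b := (K.D_nonneg m a b).trans (K.D_le_G m a b)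

/-- `1 ≤ G(0)_{aa}`. [cite: Feller1968, XIII.3; lane plumbing] -/
theorem one_le_G_zero (a : ι) : 1 ≤ K.G 0 a a := by
  rw [G_apply]; simp [K.D_nonneg 0 a a]

/-- ★ The renewal equation as a power-series identity: `G = 1 + I · G`. [cite: Feller1968, XIII.3 (3.1)–(3.2); lane — matrix form] -/
theorem serG_eq : K.serG = 1 + K.serM * K.serG := by
  have hD : PowerSeries.mk K.D = K.serM * (1 + PowerSeries.mk K.D) := by
    ext m
    rw [mul_add, mul_one, map_add, coeff_mk, coeff_mul, K.ren m]
    simp only [coeff_serM, coeff_mk]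
  rw [serG]
  nth_rewrite 1 [hD]
  rfl

/-- `G = Σ_{k<n} I^k + I^n · G` for every `n`. [cite: Feller1968, XIII.3; lane] -/
theorem serG_eq_sum_add (n : ℕ) : K.serG = ∑ k ∈ range n, K.serM ^ k + K.serM ^ n * K.serG := by
  induction n with
  | zero => simp
  | succ n ih =>
    have h : K.serM ^ n * K.serG = K.serM ^ n + K.serM ^ (n + 1) * K.serG := by
      conv_lhs => rw [K.serG_eq]
      rw [mul_add, mul_one, ← mul_assoc, ← pow_succ]
    rw [sum_range_succ, add_assoc, ← h]
    exact ih

/-- Entrywise non-negativity of all coefficients of a matrix power series. [cite: Feller1968, XIII.3; lane plumbing] -/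
def CoeffNonneg (F : PowerSeries (Matrix ι ι ℝ)) : Prop := ∀ m a b, 0 ≤ cf m F a b

/-- Products of series with non-negative coefficients have non-negative coefficients. [cite: Feller1968, XIII.3; lane plumbing] -/
theorem CoeffNonneg.mul {F H : PowerSeries (Matrix ι ι ℝ)} (hF : CoeffNonneg F) (hH : CoeffNonneg H) : CoeffNonneg (F * H) := fun m a b => by
  rw [cf_mul]
  exact sum_nonneg fun p _ => sum_nonneg fun c _ => mul_nonneg (hF _ _ _) (hH _ _ _)

/-- `1` has non-negative coefficients. [cite: Feller1968, XIII.3; lane plumbing] -/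
theorem coeffNonneg_one : CoeffNonneg (1 : PowerSeries (Matrix ι ι ℝ)) := fun m a b => by
  rw [cf_one]; split_ifs <;> norm_num

/-- Powers of a series with non-negative coefficients have non-negative coefficients. [cite: Feller1968, XIII.3; lane plumbing] -/
theorem CoeffNonneg.pow {F : PowerSeries (Matrix ι ι ℝ)} (hF : CoeffNonneg F) : ∀ k : ℕ, CoeffNonneg (F ^ k) := by
  intro k
  induction k with
  | zero => rw [pow_zero]; exact coeffNonneg_one
  | succ k ih => rw [pow_succ]; exact CoeffNonneg.mul ih hF

/-- `I` has non-negative coefficients. [cite: Feller1968, XIII.3; lane plumbing] -/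
theorem coeffNonneg_serM : CoeffNonneg K.serM := fun m a b => by rw [cf_serM]; exact K.M_nonneg m a b

/-- `G` has non-negative coefficients. [cite: Feller1968, XIII.3; lane plumbing] -/
theorem coeffNonneg_serG : CoeffNonneg K.serG := fun m a b => K.G_nonneg m a b

/-- Monotonicity of products: `0 ≤ F ≤ F'`, `0 ≤ H ≤ H'` coefficientwise ⇒ `F·H ≤ F'·H'`. [cite: Feller1968, XIII.3; lane plumbing] -/
theorem cf_mul_le_of_le {F F' H H' : PowerSeries (Matrix ι ι ℝ)} (hF : CoeffNonneg F) (hH : CoeffNonneg H)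
    (hFF : ∀ m a b, cf m F a b ≤ cf m F' a b) (hHH : ∀ m a b, cf m H a b ≤ cf m H' a b) (m : ℕ) (a b : ι) :
    cf m (F * H) a b ≤ cf m (F' * H') a b := by
  rw [cf_mul, cf_mul]
  refine sum_le_sum fun p _ => sum_le_sum fun c _ => ?_
  exact mul_le_mul (hFF _ _ _) (hHH _ _ _) (hH _ _ _) ((hF _ _ _).trans (hFF _ _ _))

/-- `Σ_{k<n} [s^m] (I^k)_{ab} ≤ G(m)_{ab}`. [cite: Feller1968, XIII.3; lane] -/
theorem sum_cf_pow_le_G (n m : ℕ) (a b : ι) : ∑ k ∈ range n, cf m (K.serM ^ k) a b ≤ K.G m a b := by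
  have h := congr_arg (fun F => cf m F a b) (K.serG_eq_sum_add n)
  simp only [cf_add, cf_sum] at h
  rw [G, h]
  exact le_add_of_nonneg_right (((K.coeffNonneg_serM.pow n).mul K.coeffNonneg_serG) m a b)

/-- The series `Σ_k [s^m] (I^k)_{ab}` converges. [cite: Feller1968, XIII.3; lane] -/
theorem summable_cf_pow (m : ℕ) (a b : ι) : Summable fun k => cf m (K.serM ^ k) a b :=
  summable_of_sum_range_le (fun k => (K.coeffNonneg_serM.pow k) m a b) (fun n => K.sum_cf_pow_le_G n m a b)

/-- The remainder `[s^m](I^n G)_{ab} → 0` as `n → ∞`. [cite: Feller1968, XIII.3; lane] -/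
theorem tendsto_cf_pow_mul_serG (m : ℕ) (a b : ι) :
    Tendsto (fun n => cf m (K.serM ^ n * K.serG) a b) atTop (𝓝 0) := by
  simp_rw [cf_mul]
  have h0 : (0 : ℝ) = ∑ p ∈ antidiagonal m, ∑ c : ι, (0 : ℝ) * cf p.2 K.serG c b := by simp
  rw [h0]
  refine tendsto_finsetSum _ fun p _ => tendsto_finsetSum _ fun c _ => Tendsto.mul_const _ ?_
  exact (K.summable_cf_pow p.1 a c).tendsto_atTop_zero

/-- ★ `G(m)_{ab} = Σ_{k≥0} [s^m] (I^k)_{ab}` — `1 + D = Σ_k I^k` coefficientwise. [cite: Feller1968, XIII.3; lane — matrix form] -/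
theorem G_eq_tsum (m : ℕ) (a b : ι) : K.G m a b = ∑' k, cf m (K.serM ^ k) a b := by
  have h1 : Tendsto (fun n => ∑ k ∈ range n, cf m (K.serM ^ k) a b + cf m (K.serM ^ n * K.serG) a b) atTop
      (𝓝 (∑' k, cf m (K.serM ^ k) a b + 0)) :=
    (K.summable_cf_pow m a b).hasSum.tendsto_sum_nat.add (K.tendsto_cf_pow_mul_serG m a b)
  rw [add_zero] at h1
  have h2 : ∀ n, ∑ k ∈ range n, cf m (K.serM ^ k) a b + cf m (K.serM ^ n * K.serG) a b = K.G m a b := fun n => by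
    have h := congr_arg (fun F => cf m F a b) (K.serG_eq_sum_add n)
    simp only [cf_add, cf_sum] at h
    rw [G, h]
  simp_rw [h2] at h1
  exact tendsto_nhds_unique tendsto_const_nhds h1

/-! ### §2 The positivity semigroup -/

/-- `Pos m a b`: some `k`-piece term has a positive coefficient at length `m` from `a` to `b`. [cite: Feller1968, XIII.3–4; lane «pcv-sawmu»] -/
def Pos (m : ℕ) (a b : ι) : Prop := ∃ k : ℕ, 0 < cf m (K.serM ^ k) a b

variable {K} in
/-- Concatenation: `Pos m a c → Pos n c b → Pos (m + n) a b`. [cite: Feller1968, XIII.3; lane] -/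
theorem Pos.add {m n : ℕ} {a b c : ι} (h1 : K.Pos m a c) (h2 : K.Pos n c b) : K.Pos (m + n) a b := by
  obtain ⟨k, hk⟩ := h1
  obtain ⟨l, hl⟩ := h2
  refine ⟨k + l, ?_⟩
  rw [pow_add, cf_mul]
  have hmem : (m, n) ∈ antidiagonal (m + n) := by simp
  have hnn : ∀ (p : ℕ × ℕ) (d : ι), 0 ≤ cf p.1 (K.serM ^ k) a d * cf p.2 (K.serM ^ l) d b := fun p d =>
    mul_nonneg ((K.coeffNonneg_serM.pow k) _ _ _) ((K.coeffNonneg_serM.pow l) _ _ _)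
  refine lt_of_lt_of_le ?_ (single_le_sum (f := fun p : ℕ × ℕ => ∑ d, cf p.1 (K.serM ^ k) a d * cf p.2 (K.serM ^ l) d b)
    (fun p _ => sum_nonneg fun d _ => hnn p d) hmem)
  exact lt_of_lt_of_le (mul_pos hk hl) (single_le_sum (f := fun d => cf m (K.serM ^ k) a d * cf n (K.serM ^ l) d b)
    (fun d _ => hnn (m, n) d) (mem_univ c))

/-- `Pos m a b ↔ 0 < G(m)_{ab}`. [cite: Feller1968, XIII.3–4; lane «pcv-sawmu»] -/
theorem pos_iff (m : ℕ) (a b : ι) : K.Pos m a b ↔ 0 < K.G m a b := by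
  rw [K.G_eq_tsum]
  constructor
  · rintro ⟨k, hk⟩
    exact lt_of_lt_of_le hk ((K.summable_cf_pow m a b).le_tsum k fun j _ => (K.coeffNonneg_serM.pow j) m a b)
  · intro h
    by_contra hne
    simp only [Pos, not_exists, not_lt] at hne
    have : ∑' k, cf m (K.serM ^ k) a b = 0 :=
      (tsum_congr fun k => le_antisymm (hne k) ((K.coeffNonneg_serM.pow k) m a b)).trans tsum_zero
    rw [this] at h
    exact lt_irrefl _ h

/-! ### §3 Taboo at a level `e`: the first-passage decomposition -/

section Taboo

variable (e : ι)

/-- `J(j)`: the one-piece kernel with the column `e` deleted (pieces NOT ending at level `e`).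
[cite: Feller1968, XIII.3 (taboo / first passage); lane] -/
def J (j : ℕ) : Matrix ι ι ℝ := Matrix.of fun a b => if b = e then 0 else K.M j a b

/-- `Mₑ(j)`: the column `e` of the one-piece kernel (pieces ending at level `e`). [cite: Feller1968, XIII.3–4; lane «pcv-sawmu»] -/
def Me (j : ℕ) : Matrix ι ι ℝ := Matrix.of fun a b => if b = e then K.M j a b else 0

/-- `Σ_j J(j) s^j`. [cite: Feller1968, XIII.3–4; lane «pcv-sawmu»] -/
def serJ : PowerSeries (Matrix ι ι ℝ) := PowerSeries.mk (K.J e)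

/-- `Σ_j Mₑ(j) s^j`. [cite: Feller1968, XIII.3–4; lane «pcv-sawmu»] -/
def serMe : PowerSeries (Matrix ι ι ℝ) := PowerSeries.mk (K.Me e)

/-- `[s^m] J_{ab}`. [cite: Feller1968, XIII.3; lane plumbing] -/
theorem cf_serJ (m : ℕ) (a b : ι) : cf m (K.serJ e) a b = if b = e then 0 else K.M m a b := by
  rw [serJ, cf_mk, J, Matrix.of_apply]

/-- `[s^m] (Mₑ)_{ab}`. [cite: Feller1968, XIII.3; lane plumbing] -/
theorem cf_serMe (m : ℕ) (a b : ι) : cf m (K.serMe e) a b = if b = e then K.M m a b else 0 := by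
  rw [serMe, cf_mk, Me, Matrix.of_apply]

/-- `I = J + Mₑ`. [cite: Feller1968, XIII.3–4; lane «pcv-sawmu»] -/
theorem serM_eq_add : K.serM = K.serJ e + K.serMe e := by
  refine PowerSeries.ext fun m => Matrix.ext fun a b => ?_
  change cf m K.serM a b = cf m (K.serJ e + K.serMe e) a b
  rw [cf_add, cf_serM, cf_serJ, cf_serMe]
  split_ifs <;> simp

/-- `J` has non-negative coefficients. [cite: Feller1968, XIII.3; lane plumbing] -/
theorem coeffNonneg_serJ : CoeffNonneg (K.serJ e) := fun m a b => by
  rw [cf_serJ]; split_ifs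
  · exact le_rfl
  · exact K.M_nonneg m a b

/-- `Mₑ` has non-negative coefficients. [cite: Feller1968, XIII.3; lane plumbing] -/
theorem coeffNonneg_serMe : CoeffNonneg (K.serMe e) := fun m a b => by
  rw [cf_serMe]; split_ifs
  · exact K.M_nonneg m a b
  · exact le_rfl

/-- `J ≤ I` coefficientwise. [cite: Feller1968, XIII.3; lane plumbing] -/
theorem cf_serJ_le (m : ℕ) (a b : ι) : cf m (K.serJ e) a b ≤ cf m K.serM a b := by
  rw [cf_serJ, cf_serM]; split_ifs
  · exact K.M_nonneg m a b
  · exact le_rfl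

/-- `[s^m] J^k ≤ [s^m] I^k`. [cite: Feller1968, XIII.3; lane plumbing] -/
theorem cf_serJ_pow_le (k m : ℕ) (a b : ι) : cf m (K.serJ e ^ k) a b ≤ cf m (K.serM ^ k) a b := by
  induction k generalizing m a b with
  | zero => simp
  | succ k ih =>
    rw [pow_succ, pow_succ]
    exact cf_mul_le_of_le ((K.coeffNonneg_serJ e).pow k) (K.coeffNonneg_serJ e) ih (K.cf_serJ_le e) m a b

/-- Anything times `J` has a vanishing column `e`. [cite: Feller1968, XIII.3–4; lane «pcv-sawmu»] -/
theorem cf_mul_serJ_col (F : PowerSeries (Matrix ι ι ℝ)) (m : ℕ) (a : ι) : cf m (F * K.serJ e) a e = 0 := by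
  rw [cf_mul]
  exact sum_eq_zero fun p _ => sum_eq_zero fun c _ => by rw [cf_serJ, if_pos rfl, mul_zero]

/-- `[s^m] (J^{k+1})_{ae} = 0`. [cite: Feller1968, XIII.3–4; lane «pcv-sawmu»] -/
theorem cf_serJ_pow_succ_col (k m : ℕ) (a : ι) : cf m (K.serJ e ^ (k + 1)) a e = 0 := by
  rw [pow_succ]; exact K.cf_mul_serJ_col e _ m a

/-- The series `Σ_k [s^m] (J^k)_{ab}` converges (dominated by `Σ_k [s^m] I^k = G(m)`). [cite: Feller1968, XIII.3–4; lane «pcv-sawmu»] -/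
theorem summable_cf_serJ_pow (m : ℕ) (a b : ι) : Summable fun k => cf m (K.serJ e ^ k) a b :=
  (K.summable_cf_pow m a b).of_nonneg_of_le (fun k => ((K.coeffNonneg_serJ e).pow k) m a b)
    (fun k => K.cf_serJ_pow_le e k m a b)

/-- The TABOO kernel `N(m)_{ab} = Σ_k [s^m] (J^k)_{ab}` (sequences of pieces avoiding the level `e` after the start).
[cite: Feller1968, XIII.3; lane] -/
def N (m : ℕ) (a b : ι) : ℝ := ∑' k, cf m (K.serJ e ^ k) a b

/-- `Σ_m N(m) s^m`. [cite: Feller1968, XIII.3–4; lane «pcv-sawmu»] -/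
def serN : PowerSeries (Matrix ι ι ℝ) := PowerSeries.mk fun m => Matrix.of fun a b => K.N e m a b

/-- `[s^m] N_{ab} = N(m)_{ab}`. [cite: Feller1968, XIII.3; lane plumbing] -/
theorem cf_serN (m : ℕ) (a b : ι) : cf m (K.serN e) a b = K.N e m a b := by
  rw [serN, cf_mk, Matrix.of_apply]

/-- `N ≥ 0`. [cite: Feller1968, XIII.3; lane plumbing] -/
theorem N_nonneg (m : ℕ) (a b : ι) : 0 ≤ K.N e m a b := tsum_nonneg fun k => ((K.coeffNonneg_serJ e).pow k) m a b

/-- `N` has non-negative coefficients. [cite: Feller1968, XIII.3; lane plumbing] -/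
theorem coeffNonneg_serN : CoeffNonneg (K.serN e) := fun m a b => by rw [cf_serN]; exact K.N_nonneg e m a b

/-- The column `e` of the taboo kernel: `N(m)_{ae} = [m = 0][a = e]`. [cite: Feller1968, XIII.3–4; lane «pcv-sawmu»] -/
theorem N_col (m : ℕ) (a : ι) : K.N e m a e = if m = 0 ∧ a = e then 1 else 0 := by
  rw [N, tsum_eq_single 0]
  · rw [pow_zero, cf_one]
  · intro k hk
    obtain ⟨j, rfl⟩ := Nat.exists_eq_succ_of_ne_zero hk
    exact K.cf_serJ_pow_succ_col e j m a

/-- ★ The taboo renewal identity `N = 1 + N · J`. [cite: Feller1968, XIII.3; lane] -/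
theorem serN_eq : K.serN e = 1 + K.serN e * K.serJ e := by
  refine PowerSeries.ext fun m => Matrix.ext fun a b => ?_
  change cf m (K.serN e) a b = cf m (1 + K.serN e * K.serJ e) a b
  rw [cf_add, cf_mul, cf_serN, cf_one]
  have hsplit : K.N e m a b = cf m (K.serJ e ^ 0) a b + ∑' k, cf m (K.serJ e ^ (k + 1)) a b :=
    (K.summable_cf_serJ_pow e m a b).tsum_eq_zero_add
  rw [hsplit, pow_zero, cf_one]
  congr 1
  have hterm : ∀ p ∈ antidiagonal m, ∑ c, cf p.1 (K.serN e) a c * cf p.2 (K.serJ e) c b =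
      ∑' k, ∑ c, cf p.1 (K.serJ e ^ k) a c * cf p.2 (K.serJ e) c b := fun p _ => by
    rw [Summable.tsum_finsetSum (fun c _ => (K.summable_cf_serJ_pow e p.1 a c).mul_right _)]
    exact sum_congr rfl fun c _ => by rw [cf_serN, N, tsum_mul_right]
  rw [sum_congr rfl hterm, ← Summable.tsum_finsetSum (fun p _ => summable_sum fun c _ =>
    (K.summable_cf_serJ_pow e p.1 a c).mul_right _)]
  exact tsum_congr fun k => by rw [pow_succ, cf_mul]

/-- ★ The RESOLVENT IDENTITY `G − N = N · Mₑ · G` (pure ring algebra from `G = 1 + I G`, `N = 1 + N J`, `I = J + Mₑ`).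
[cite: Feller1968, XIII.3; lane] -/
theorem serG_sub_serN : K.serG - K.serN e = K.serN e * K.serMe e * K.serG := by
  have hG := K.serG_eq
  have hN := K.serN_eq e
  have hM := K.serM_eq_add e
  have h1 : K.serM * K.serG = K.serG - 1 := by
    conv_rhs => rw [hG]
    abel
  have h2 : K.serN e * K.serJ e = K.serN e - 1 := by
    conv_rhs => rw [hN]
    abel
  have h3 : K.serMe e = K.serM - K.serJ e := by rw [hM]; abel
  calc K.serG - K.serN e
      = K.serN e * (K.serG - 1) - (K.serN e - 1) * K.serG := by noncomm_ring
    _ = K.serN e * (K.serM * K.serG) - (K.serN e * K.serJ e) * K.serG := by rw [h1, h2]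
    _ = K.serN e * K.serMe e * K.serG := by rw [h3]; noncomm_ring

/-- The FIRST-PASSAGE COEFFICIENTS to the level `e`: `φ_c(m) = [s^m] (N · I)_{ce} ≥ 0` — total weight of the sequences of pieces
from `c` that reach the level `e` for the first time (after the start) at total length `m`.
[cite: Feller1968, XIII.3–4 (first passage); lane] -/
def phi (c : ι) (m : ℕ) : ℝ := cf m (K.serN e * K.serM) c e

/-- `φ ≥ 0`. [cite: Feller1968, XIII.3; lane plumbing] -/
theorem phi_nonneg (c : ι) (m : ℕ) : 0 ≤ K.phi e c m := ((K.coeffNonneg_serN e).mul K.coeffNonneg_serM) m c e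

/-- `[s^q](N Mₑ)_{cd} = [d = e] φ_c(q)`. [cite: Feller1968, XIII.3–4; lane «pcv-sawmu»] -/
theorem cf_serN_mul_serMe (q : ℕ) (c d : ι) : cf q (K.serN e * K.serMe e) c d = if d = e then K.phi e c q else 0 := by
  rw [cf_mul]
  by_cases hd : d = e
  · subst hd
    rw [if_pos rfl, phi, cf_mul]
    refine sum_congr rfl fun p _ => sum_congr rfl fun c' _ => ?_
    rw [cf_serMe, cf_serM, if_pos rfl]
  · rw [if_neg hd]
    exact sum_eq_zero fun p _ => sum_eq_zero fun c' _ => by rw [cf_serMe, if_neg hd, mul_zero]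

/-- ★ THE FIRST-PASSAGE DECOMPOSITION in the column `e`:
`G(m)_{ce} = [m = 0][c = e] + Σ_{i+j=m} φ_c(i) · G(j)_{ee}`.
[cite: Feller1968, XIII.3 Theorem 1 / XIII.4 (first passage and renewal equation); lane — matrix/taboo form] -/
theorem G_col_eq (c : ι) (m : ℕ) :
    K.G m c e = (if m = 0 ∧ c = e then 1 else 0) + ∑ p ∈ antidiagonal m, K.phi e c p.1 * K.G p.2 e e := by
  have h := congr_arg (fun F => cf m F c e) (K.serG_sub_serN e)
  simp only [cf_sub] at h
  rw [cf_serN, N_col] at h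
  have h2 : cf m (K.serN e * K.serMe e * K.serG) c e = ∑ p ∈ antidiagonal m, K.phi e c p.1 * K.G p.2 e e := by
    rw [cf_mul]
    refine sum_congr rfl fun p _ => ?_
    simp_rw [cf_serN_mul_serMe, ite_mul, zero_mul, sum_ite_eq', mem_univ, if_true]
    rfl
  rw [G]
  linarith [h, h2]

/-- The RENEWAL SEQUENCE at the level `e`: `u(m) = G(m)_{ee}`. [cite: Feller1968, XIII.3; lane] -/
def u (m : ℕ) : ℝ := K.G m e e

/-- `u ≥ 0`. [cite: Feller1968, XIII.3; lane plumbing] -/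
theorem u_nonneg (m : ℕ) : 0 ≤ K.u e m := K.G_nonneg m e e

/-- `1 ≤ u(0)`. [cite: Feller1968, XIII.3; lane plumbing] -/
theorem one_le_u_zero : 1 ≤ K.u e 0 := K.one_le_G_zero e

/-- ★ The scalar renewal equation at the level `e`: `u(m) = δ_{m0} + Σ_{i+j=m} φ_e(i) u(j)`.
[cite: Feller1968, XIII.3 (3.1); MadrasSlade1993, (B.1); lane] -/
theorem u_eq (m : ℕ) : K.u e m = (if m = 0 then 1 else 0) + ∑ p ∈ antidiagonal m, K.phi e e p.1 * K.u e p.2 := by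
  have h := K.G_col_eq e e m
  simp only [and_true] at h
  exact h

/-- ★ The delayed renewal equation: for `c ≠ e`, `D(m)_{ce} = Σ_{i+j=m} φ_c(i) u(j)`.
[cite: Feller1968, XIII.4 (delayed recurrent events); MadrasSlade1993, Theorem 4.2.2; lane] -/
theorem D_col_eq {c : ι} (hc : c ≠ e) (m : ℕ) : K.D m c e = ∑ p ∈ antidiagonal m, K.phi e c p.1 * K.u e p.2 := by
  have h := K.G_col_eq e c m
  rw [G_apply] at h
  simpa [hc, u] using h

/-- `φ_c(m) ≤ G(m)_{ce}` (the term `i = m, j = 0` of the decomposition, `u(0) ≥ 1`). [cite: Feller1968, XIII.3–4; lane «pcv-sawmu»] -/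
theorem phi_le_G (c : ι) (m : ℕ) : K.phi e c m ≤ K.G m c e := by
  have h := K.G_col_eq e c m
  have hnn : ∀ p ∈ antidiagonal m, 0 ≤ K.phi e c p.1 * K.G p.2 e e :=
    fun p _ => mul_nonneg (K.phi_nonneg e c _) (K.G_nonneg _ e e)
  have hmem : (m, 0) ∈ antidiagonal m := by simp
  have h1 := single_le_sum (f := fun p : ℕ × ℕ => K.phi e c p.1 * K.G p.2 e e) hnn hmem
  have h2 : K.phi e c m ≤ K.phi e c m * K.G 0 e e := le_mul_of_one_le_right (K.phi_nonneg e c m) (K.one_le_G_zero e)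
  have h3 : (0 : ℝ) ≤ if m = 0 ∧ c = e then 1 else 0 := by split_ifs <;> norm_num
  calc K.phi e c m ≤ ∑ p ∈ antidiagonal m, K.phi e c p.1 * K.G p.2 e e := h2.trans h1
    _ ≤ (if m = 0 ∧ c = e then 1 else 0) + ∑ p ∈ antidiagonal m, K.phi e c p.1 * K.G p.2 e e := le_add_of_nonneg_left h3
    _ = K.G m c e := h.symm

/-- `φ_c(m) ≤ D(m)_{ce}` for `m ≥ 1`. [cite: Feller1968, XIII.3–4; lane «pcv-sawmu»] -/
theorem phi_le_D (c : ι) {m : ℕ} (hm : m ≠ 0) : K.phi e c m ≤ K.D m c e := by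
  rw [← K.G_eq_D hm]; exact K.phi_le_G e c m

end Taboo

/-! ### §4 Three lemmas on power series with non-negative coefficients -/

/-- Cauchy product with powers: `Σ_m (Σ_{i+j=m} f_i g_j) s^m = (Σ_m f_m s^m)(Σ_m g_m s^m)` for non-negative summable data.
[cite: Feller1968, XIII.3; lane plumbing (Mathlib `Summable.tsum_mul_tsum_eq_tsum_sum_antidiagonal`)] -/
private theorem tsum_antidiagonal_mul_pow {f g : ℕ → ℝ} (hf : ∀ m, 0 ≤ f m) (hg : ∀ m, 0 ≤ g m) {s : ℝ} (hs : 0 ≤ s)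
    (hfs : Summable fun m => f m * s ^ m) (hgs : Summable fun m => g m * s ^ m) :
    (Summable fun m => (∑ p ∈ antidiagonal m, f p.1 * g p.2) * s ^ m) ∧
      ∑' m, (∑ p ∈ antidiagonal m, f p.1 * g p.2) * s ^ m = (∑' m, f m * s ^ m) * ∑' m, g m * s ^ m := by
  have hfg : Summable fun x : ℕ × ℕ => (fun m => f m * s ^ m) x.1 * (fun m => g m * s ^ m) x.2 :=
    hfs.mul_of_nonneg hgs (fun m => mul_nonneg (hf m) (pow_nonneg hs m)) (fun m => mul_nonneg (hg m) (pow_nonneg hs m))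
  have h1 := summable_sum_mul_antidiagonal_of_summable_mul (f := fun m => f m * s ^ m) (g := fun m => g m * s ^ m) hfg
  have h2 := hfs.tsum_mul_tsum_eq_tsum_sum_antidiagonal hgs hfg
  have hterm : ∀ m, ∑ p ∈ antidiagonal m, f p.1 * s ^ p.1 * (g p.2 * s ^ p.2) =
      (∑ p ∈ antidiagonal m, f p.1 * g p.2) * s ^ m := fun m => by
    rw [sum_mul]
    refine sum_congr rfl fun p hp => ?_
    have hp' : p.1 + p.2 = m := HasAntidiagonal.mem_antidiagonal.mp hp
    rw [← hp', pow_add]; ring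
  simp only [hterm] at h1 h2
  exact ⟨h1, h2.symm⟩

/-- Monotone convergence at the radius: if `φ ≥ 0`, `Σ φ_m s^m` converges for `0 ≤ s < 1` and tends to `r` as `s ↑ 1`, then
`Σ φ_m = r`. [cite: Feller1971, XIII.5; lane plumbing (Abel / monotone convergence for non-negative series)] -/
private theorem hasSum_of_tendsto_powerSeries {φ : ℕ → ℝ} (hφ : ∀ m, 0 ≤ φ m)
    (hs : ∀ s : ℝ, 0 ≤ s → s < 1 → Summable fun m => φ m * s ^ m) {r : ℝ}
    (hlim : Tendsto (fun s : ℝ => ∑' m, φ m * s ^ m) (𝓝[<] 1) (𝓝 r)) : HasSum φ r := by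
  have hIco : ∀ᶠ s : ℝ in 𝓝[<] 1, s ∈ Set.Ico (0 : ℝ) 1 := Ico_mem_nhdsLT zero_lt_one
  -- partial sums are `≤ r`
  have hpart : ∀ N, ∑ m ∈ range N, φ m ≤ r := fun N => by
    have hpoly : Tendsto (fun s : ℝ => ∑ m ∈ range N, φ m * s ^ m) (𝓝[<] 1) (𝓝 (∑ m ∈ range N, φ m)) := by
      have : Tendsto (fun s : ℝ => ∑ m ∈ range N, φ m * s ^ m) (𝓝 1) (𝓝 (∑ m ∈ range N, φ m * 1 ^ m)) :=
        tendsto_finsetSum _ fun m _ => ((continuous_pow m).tendsto 1).const_mul _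
      simp only [one_pow, mul_one] at this
      exact this.mono_left nhdsWithin_le_nhds
    refine le_of_tendsto_of_tendsto hpoly hlim ?_
    filter_upwards [hIco] with s hs'
    exact (hs s hs'.1 hs'.2).sum_le_tsum _ (fun m _ => mul_nonneg (hφ m) (pow_nonneg hs'.1 m))
  have hsum : Summable φ := summable_of_sum_range_le hφ hpart
  have hle : ∑' m, φ m ≤ r := hsum.tsum_le_of_sum_range_le hpart
  -- and `Σ φ ≥ r`
  have hge : r ≤ ∑' m, φ m := by
    refine le_of_tendsto hlim ?_
    filter_upwards [hIco] with s hs'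
    refine (hs s hs'.1 hs'.2).tsum_le_tsum (fun m => ?_) hsum
    exact mul_le_of_le_one_right (hφ m) (pow_le_one₀ hs'.1 hs'.2.le)
  rw [show r = ∑' m, φ m from le_antisymm hge hle]
  exact hsum.hasSum

/-- The ABELIAN direction of the Hardy–Littlewood theorem (index one), from the tree: if `q ≥ 0` and `q_n → C > 0` then
`(1 − s) Σ q_n s^n → C` as `s ↑ 1`. [cite: Feller1971, XIII.5 Theorem 5 (easy half)] -/
private theorem tendsto_one_sub_mul_tsum_of_tendsto {q : ℕ → ℝ} (hq : ∀ n, 0 ≤ q n) {C : ℝ} (hC : 0 < C)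
    (hlim : Tendsto q atTop (𝓝 C)) :
    Tendsto (fun s : ℝ => (1 - s) * ∑' n, q n * s ^ n) (𝓝[<] 1) (𝓝 C) := by
  have hces : Tendsto (fun n : ℕ => (∑ k ∈ range n, q k) / (n : ℝ) ^ (1 : ℝ)) atTop (𝓝 (C / Real.Gamma (1 + 1))) := by
    have h2 : Real.Gamma (1 + 1) = 1 := by norm_num [Real.Gamma_two]
    rw [h2, div_one]
    refine hlim.cesaro.congr fun n => ?_
    rw [Real.rpow_one, div_eq_inv_mul]
  have h := ((Literature.Analysis.Asymptotics.hardyLittlewood_powerSeries_iff hq zero_le_one hC).mpr hces).2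
  refine h.congr fun s => ?_
  rw [Real.rpow_one]

/-! ### §5 The critical regime: generating functions at a level `e` -/

/-- The CRITICAL REGIME of a matrix renewal pair, with Abelian limits `L`: the generating functions `Σ_m D(m)_{ab} s^m` converge
for `0 ≤ s < 1` and `(1 − s) Σ_m D(m)_{ab} s^m → L_{ab} > 0` as `s ↑ 1` (criticality + "rank-one residue"), the one-piece kernel
has a finite first moment `Σ_j j M(j)_{ab} < ∞` (positive recurrence), and `gcd {m : D(m)_{oo} > 0} = 1` at some level `o`
(aperiodicity).
[cite: Feller1968, XIII.3–4, XIII.11; Seneta1973, Chapter 6; lane «pcv-sawmu»] -/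
structure Critical (L : ι → ι → ℝ) : Prop where
  /-- `Σ_m D(m)_{ab} s^m < ∞` for `0 ≤ s < 1` -/
  summable : ∀ (a b : ι) (s : ℝ), 0 ≤ s → s < 1 → Summable fun m => K.D m a b * s ^ m
  /-- the Abelian (residue) hypothesis `(1 − s) Σ_m D(m)_{ab} s^m → L_{ab}` -/
  abel : ∀ a b : ι, Tendsto (fun s : ℝ => (1 - s) * ∑' m, K.D m a b * s ^ m) (𝓝[<] 1) (𝓝 (L a b))
  /-- `L > 0` -/
  pos : ∀ a b : ι, 0 < L a b
  /-- finite first moment of the one-piece kernel -/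
  mean : ∀ a b : ι, Summable fun j : ℕ => (j : ℝ) * K.M j a b
  /-- aperiodicity at one level: `gcd {m : D(m)_{oo} > 0} = 1` -/
  aper : ∃ o : ι, Nat.setGcd {m : ℕ | 0 < K.D m o o} = 1

section Critical

variable {K} {L : ι → ι → ℝ} (h : K.Critical L) (e : ι)
include h

/-- Irreducibility is a consequence of `L > 0`: for all `a, b` some `G(m)_{ab} > 0`. [cite: Feller1968, XIII.3–4; lane «pcv-sawmu»] -/
theorem Critical.exists_pos (a b : ι) : ∃ m, K.Pos m a b := by
  by_contra hne
  rw [not_exists] at hne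
  have hD0 : ∀ m, K.D m a b = 0 := fun m => by
    have h1 : ¬ 0 < K.G m a b := fun hh => hne m ((K.pos_iff m a b).2 hh)
    have h2 : K.G m a b = 0 := le_antisymm (not_lt.1 h1) (K.G_nonneg m a b)
    exact le_antisymm (h2 ▸ K.D_le_G m a b) (K.D_nonneg m a b)
  have hlim := h.abel a b
  simp only [hD0, zero_mul, tsum_zero, mul_zero] at hlim
  have := tendsto_nhds_unique (tendsto_const_nhds (x := (0 : ℝ))) hlim
  exact absurd this (h.pos a b).ne

/-- `Σ_m G(m)_{ab} s^m < ∞` on `[0,1)`. [cite: Feller1968, XIII.3–4; lane «pcv-sawmu»] -/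
theorem Critical.summable_G (a b : ι) {s : ℝ} (hs0 : 0 ≤ s) (hs1 : s < 1) : Summable fun m => K.G m a b * s ^ m := by
  have hfin : Summable fun m : ℕ => (if m = 0 ∧ a = b then (1 : ℝ) else 0) * s ^ m := by
    refine summable_of_ne_finset_zero (s := {0}) fun m hm => ?_
    rw [mem_singleton] at hm
    simp [hm]
  simpa only [G_apply, add_mul] using hfin.add (h.summable a b s hs0 hs1)

/-- `Σ_m φ_c(m) s^m < ∞` on `[0,1)`. [cite: Feller1968, XIII.3–4; lane «pcv-sawmu»] -/
theorem Critical.summable_phi (c : ι) {s : ℝ} (hs0 : 0 ≤ s) (hs1 : s < 1) : Summable fun m => K.phi e c m * s ^ m :=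
  (h.summable_G c e hs0 hs1).of_nonneg_of_le (fun m => mul_nonneg (K.phi_nonneg e c m) (pow_nonneg hs0 m))
    (fun m => mul_le_mul_of_nonneg_right (K.phi_le_G e c m) (pow_nonneg hs0 m))

/-- `Σ_m u(m) s^m = 1 + Σ_m D(m)_{ee} s^m` on `[0,1)`. [cite: Feller1968, XIII.3–4; lane «pcv-sawmu»] -/
theorem Critical.tsum_u_eq {s : ℝ} (hs0 : 0 ≤ s) (hs1 : s < 1) :
    ∑' m, K.u e m * s ^ m = 1 + ∑' m, K.D m e e * s ^ m := by
  have hfin : ∀ m, m ∉ ({0} : Finset ℕ) → (if m = 0 then (1 : ℝ) else 0) * s ^ m = 0 := fun m hm => by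
    rw [mem_singleton] at hm; simp [hm]
  have h1 : ∑' m : ℕ, (if m = 0 then (1 : ℝ) else 0) * s ^ m = 1 := by
    rw [tsum_eq_sum hfin]; simp
  have h2 : ∀ m, K.u e m * s ^ m = (if m = 0 then (1 : ℝ) else 0) * s ^ m + K.D m e e * s ^ m := fun m => by
    rw [u, G_apply, add_mul]; simp
  rw [tsum_congr h2, (summable_of_ne_finset_zero hfin).tsum_add (h.summable e e s hs0 hs1), h1]

/-- ★ `(1 − s) Σ_m u(m) s^m → L_{ee}` as `s ↑ 1`. [cite: Feller1968, XIII.3–4; lane «pcv-sawmu»] -/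
theorem Critical.tendsto_one_sub_mul_tsum_u :
    Tendsto (fun s : ℝ => (1 - s) * ∑' m, K.u e m * s ^ m) (𝓝[<] 1) (𝓝 (L e e)) := by
  have hIco : ∀ᶠ s : ℝ in 𝓝[<] 1, s ∈ Set.Ico (0 : ℝ) 1 := Ico_mem_nhdsLT zero_lt_one
  have h1 : Tendsto (fun s : ℝ => (1 - s) + (1 - s) * ∑' m, K.D m e e * s ^ m) (𝓝[<] 1) (𝓝 (0 + L e e)) := by
    refine Tendsto.add ?_ (h.abel e e)
    have : Tendsto (fun s : ℝ => 1 - s) (𝓝 1) (𝓝 (1 - 1)) := tendsto_const_nhds.sub tendsto_id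
    rw [sub_self] at this
    exact this.mono_left nhdsWithin_le_nhds
  rw [zero_add] at h1
  refine h1.congr' ?_
  filter_upwards [hIco] with s hs
  rw [h.tsum_u_eq e hs.1 hs.2]; ring

/-- ★ The generating-function form of the renewal equation: `û(s) = 1 + φ̂_e(s) û(s)` on `[0,1)`. [cite: Feller1968, XIII.3 (3.2); lane] -/
theorem Critical.tsum_u_eq_one_add {s : ℝ} (hs0 : 0 ≤ s) (hs1 : s < 1) :
    ∑' m, K.u e m * s ^ m = 1 + (∑' m, K.phi e e m * s ^ m) * ∑' m, K.u e m * s ^ m := by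
  have hsu : Summable fun m => K.u e m * s ^ m := h.summable_G e e hs0 hs1
  obtain ⟨hconv, hprod⟩ := tsum_antidiagonal_mul_pow (K.phi_nonneg e e) (K.u_nonneg e) hs0 (h.summable_phi e e hs0 hs1) hsu
  have hfin : ∀ m, m ∉ ({0} : Finset ℕ) → (if m = 0 then (1 : ℝ) else 0) * s ^ m = 0 := fun m hm => by
    rw [mem_singleton] at hm; simp [hm]
  have h1 : ∑' m : ℕ, (if m = 0 then (1 : ℝ) else 0) * s ^ m = 1 := by
    rw [tsum_eq_sum hfin]; simp
  have h2 : ∀ m, K.u e m * s ^ m = (if m = 0 then (1 : ℝ) else 0) * s ^ m +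
      (∑ p ∈ antidiagonal m, K.phi e e p.1 * K.u e p.2) * s ^ m := fun m => by
    rw [← add_mul, ← K.u_eq e m]
  rw [← hprod, ← h1, ← (summable_of_ne_finset_zero hfin).tsum_add hconv]
  exact tsum_congr h2

/-- For `c ≠ e`: `Σ_m D(m)_{ce} s^m = φ̂_c(s) û(s)` on `[0,1)`. [cite: Feller1968, XIII.4; lane] -/
theorem Critical.tsum_D_col_eq {c : ι} (hc : c ≠ e) {s : ℝ} (hs0 : 0 ≤ s) (hs1 : s < 1) :
    ∑' m, K.D m c e * s ^ m = (∑' m, K.phi e c m * s ^ m) * ∑' m, K.u e m * s ^ m := by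
  obtain ⟨-, hprod⟩ := tsum_antidiagonal_mul_pow (K.phi_nonneg e c) (K.u_nonneg e) hs0 (h.summable_phi e c hs0 hs1)
    (h.summable_G e e hs0 hs1)
  rw [← hprod]
  exact tsum_congr fun m => by rw [K.D_col_eq e hc m]

/-- `û(s) ≥ 1` on `[0,1)`. [cite: Feller1968, XIII.3–4; lane «pcv-sawmu»] -/
theorem Critical.one_le_tsum_u {s : ℝ} (hs0 : 0 ≤ s) (hs1 : s < 1) : 1 ≤ ∑' m, K.u e m * s ^ m := by
  rw [h.tsum_u_eq e hs0 hs1]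
  exact le_add_of_nonneg_right (tsum_nonneg fun m => mul_nonneg (K.D_nonneg m e e) (pow_nonneg hs0 m))

/-- `φ̂_e(s) = 1 − 1/û(s)` on `[0,1)`. [cite: Feller1968, XIII.3 (3.2); lane] -/
theorem Critical.tsum_phi_self_eq {s : ℝ} (hs0 : 0 ≤ s) (hs1 : s < 1) :
    ∑' m, K.phi e e m * s ^ m = 1 - 1 / ∑' m, K.u e m * s ^ m := by
  have hU := h.one_le_tsum_u e hs0 hs1
  have hU0 : (∑' m, K.u e m * s ^ m) ≠ 0 := by linarith
  have heq := h.tsum_u_eq_one_add e hs0 hs1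
  field_simp
  linarith [heq]

/-- ★ Recurrence: `φ̂_e(s) → 1` as `s ↑ 1`. [cite: Feller1968, XIII.3 (persistent events); lane] -/
theorem Critical.tendsto_tsum_phi_self : Tendsto (fun s : ℝ => ∑' m, K.phi e e m * s ^ m) (𝓝[<] 1) (𝓝 1) := by
  have hIco : ∀ᶠ s : ℝ in 𝓝[<] 1, s ∈ Set.Ico (0 : ℝ) 1 := Ico_mem_nhdsLT zero_lt_one
  have hU := h.tendsto_one_sub_mul_tsum_u e
  have h0 : Tendsto (fun s : ℝ => 1 - s) (𝓝[<] (1 : ℝ)) (𝓝 0) := by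
    have : Tendsto (fun s : ℝ => 1 - s) (𝓝 1) (𝓝 (1 - 1)) := tendsto_const_nhds.sub tendsto_id
    rw [sub_self] at this
    exact this.mono_left nhdsWithin_le_nhds
  -- `1/û = (1 − s)/((1 − s) û) → 0 / L_{ee} = 0`
  have hinv : Tendsto (fun s : ℝ => 1 / ∑' m, K.u e m * s ^ m) (𝓝[<] 1) (𝓝 0) := by
    have h1 := h0.div hU (h.pos e e).ne'
    rw [zero_div] at h1
    refine h1.congr' ?_
    filter_upwards [hIco] with s hs
    have hs1 : (1 : ℝ) - s ≠ 0 := by linarith [hs.2]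
    rw [Pi.div_apply, div_mul_eq_div_div, div_self hs1]
  have h2 : Tendsto (fun s : ℝ => 1 - 1 / ∑' m, K.u e m * s ^ m) (𝓝[<] 1) (𝓝 (1 - 0)) := tendsto_const_nhds.sub hinv
  rw [sub_zero] at h2
  refine h2.congr' ?_
  filter_upwards [hIco] with s hs
  rw [h.tsum_phi_self_eq e hs.1 hs.2]

/-- For `c ≠ e`: `φ̂_c(s) → L_{ce}/L_{ee}` as `s ↑ 1`. [cite: Feller1968, XIII.3–4; lane «pcv-sawmu»] -/
theorem Critical.tendsto_tsum_phi {c : ι} (hc : c ≠ e) :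
    Tendsto (fun s : ℝ => ∑' m, K.phi e c m * s ^ m) (𝓝[<] 1) (𝓝 (L c e / L e e)) := by
  have hIco : ∀ᶠ s : ℝ in 𝓝[<] 1, s ∈ Set.Ico (0 : ℝ) 1 := Ico_mem_nhdsLT zero_lt_one
  have h1 := (h.abel c e).div (h.tendsto_one_sub_mul_tsum_u e) (h.pos e e).ne'
  refine h1.congr' ?_
  filter_upwards [hIco] with s hs
  have hs1 : (1 : ℝ) - s ≠ 0 := by linarith [hs.2]
  have hU0 : (∑' m, K.u e m * s ^ m) ≠ 0 := by linarith [h.one_le_tsum_u e hs.1 hs.2]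
  rw [Pi.div_apply, h.tsum_D_col_eq e hc hs.1 hs.2, mul_div_mul_left _ _ hs1, mul_div_assoc, div_self hU0, mul_one]

/-- ★ RECURRENCE: the first-return coefficients sum to one, `Σ_m φ_e(m) = 1`. [cite: Feller1968, XIII.3 Definition (persistent event); lane] -/
theorem Critical.hasSum_phi_self : HasSum (K.phi e e) 1 :=
  hasSum_of_tendsto_powerSeries (K.phi_nonneg e e) (fun _ hs0 hs1 => h.summable_phi e e hs0 hs1) (h.tendsto_tsum_phi_self e)

/-- For `c ≠ e`: `Σ_m φ_c(m) = L_{ce}/L_{ee}`. [cite: Feller1968, XIII.3–4; lane «pcv-sawmu»] -/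
theorem Critical.hasSum_phi {c : ι} (hc : c ≠ e) : HasSum (K.phi e c) (L c e / L e e) :=
  hasSum_of_tendsto_powerSeries (K.phi_nonneg e c) (fun _ hs0 hs1 => h.summable_phi e c hs0 hs1) (h.tendsto_tsum_phi e hc)

/-- ★ POSITIVE RECURRENCE: the first-return law has a finite mean, `Σ_m m φ_e(m) < ∞` (indeed `≤ 1/L_{ee}`).
[cite: Feller1968, XIII.3; lane — from the Abelian hypothesis by monotone convergence] -/
theorem Critical.summable_mul_phi_self : Summable fun m : ℕ => (m : ℝ) * K.phi e e m := by
  have hIco : ∀ᶠ s : ℝ in 𝓝[<] 1, s ∈ Set.Ico (0 : ℝ) 1 := Ico_mem_nhdsLT zero_lt_one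
  have hφ := K.phi_nonneg e e
  have hsumφ : Summable (K.phi e e) := (h.hasSum_phi_self e).summable
  have hnn : ∀ m : ℕ, 0 ≤ (m : ℝ) * K.phi e e m := fun m => mul_nonneg (Nat.cast_nonneg m) (hφ m)
  -- the key inequality on `[0,1)`: `Σ_{m<N} m φ_m s^m ≤ 1/((1 − s) û(s))`
  have hkey : ∀ N : ℕ, ∀ s ∈ Set.Ico (0 : ℝ) 1,
      ∑ m ∈ range N, (m : ℝ) * K.phi e e m * s ^ m ≤ 1 / ((1 - s) * ∑' m, K.u e m * s ^ m) := fun N s hs => by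
    have hs1 : 0 < 1 - s := by linarith [hs.2]
    have hU := h.one_le_tsum_u e hs.1 hs.2
    have hsφs := h.summable_phi e e hs.1 hs.2
    -- `(1 − s) m s^m ≤ 1 − s^m`
    have hgeom : ∀ m : ℕ, (1 - s) * ((m : ℝ) * s ^ m) ≤ 1 - s ^ m := fun m => by
      have h1 : (∑ i ∈ range m, s ^ i) * (1 - s) = 1 - s ^ m := by
        have := geom_sum_mul_neg s m
        linarith [this]
      have h2 : (m : ℝ) * s ^ m ≤ ∑ i ∈ range m, s ^ i := by
        have : ∑ _i ∈ range m, s ^ m ≤ ∑ i ∈ range m, s ^ i :=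
          sum_le_sum fun i hi => pow_le_pow_of_le_one hs.1 hs.2.le (mem_range.1 hi).le
        rwa [sum_const, card_range, nsmul_eq_mul] at this
      calc (1 - s) * ((m : ℝ) * s ^ m) ≤ (1 - s) * ∑ i ∈ range m, s ^ i := mul_le_mul_of_nonneg_left h2 hs1.le
        _ = 1 - s ^ m := by rw [mul_comm]; exact h1
    -- sum the inequality and compare with `Σ_m φ_m (1 − s^m) = 1 − φ̂(s) = 1/û(s)`
    have hstep : (1 - s) * ∑ m ∈ range N, (m : ℝ) * K.phi e e m * s ^ m ≤ ∑' m, K.phi e e m * (1 - s ^ m) := by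
      have hsd : Summable fun m => K.phi e e m * (1 - s ^ m) := by
        have : (fun m => K.phi e e m * (1 - s ^ m)) = fun m => K.phi e e m - K.phi e e m * s ^ m := by
          funext m; ring
        rw [this]; exact hsumφ.sub hsφs
      calc (1 - s) * ∑ m ∈ range N, (m : ℝ) * K.phi e e m * s ^ m
          = ∑ m ∈ range N, K.phi e e m * ((1 - s) * ((m : ℝ) * s ^ m)) := by rw [mul_sum]; exact sum_congr rfl fun m _ => by ring
        _ ≤ ∑ m ∈ range N, K.phi e e m * (1 - s ^ m) := sum_le_sum fun m _ => mul_le_mul_of_nonneg_left (hgeom m) (hφ m)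
        _ ≤ ∑' m, K.phi e e m * (1 - s ^ m) :=
          hsd.sum_le_tsum _ fun m _ => mul_nonneg (hφ m) (by linarith [pow_le_one₀ hs.1 hs.2.le (n := m)])
    have hval : ∑' m, K.phi e e m * (1 - s ^ m) = 1 / ∑' m, K.u e m * s ^ m := by
      have : (fun m => K.phi e e m * (1 - s ^ m)) = fun m => K.phi e e m - K.phi e e m * s ^ m := by funext m; ring
      rw [this, hsumφ.tsum_sub hsφs, (h.hasSum_phi_self e).tsum_eq, h.tsum_phi_self_eq e hs.1 hs.2]
      ring
    rw [hval] at hstep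
    have hUpos : 0 < ∑' m, K.u e m * s ^ m := by linarith
    have h3 : (1 - s) * (∑ m ∈ range N, (m : ℝ) * K.phi e e m * s ^ m) * ∑' m, K.u e m * s ^ m ≤ 1 := by
      have := (le_div_iff₀ hUpos).mp hstep
      linarith [this]
    rw [le_div_iff₀ (mul_pos hs1 hUpos)]
    calc (∑ m ∈ range N, (m : ℝ) * K.phi e e m * s ^ m) * ((1 - s) * ∑' m, K.u e m * s ^ m)
        = (1 - s) * (∑ m ∈ range N, (m : ℝ) * K.phi e e m * s ^ m) * ∑' m, K.u e m * s ^ m := by ring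
      _ ≤ 1 := h3
  -- let `s ↑ 1`
  have hlimU : Tendsto (fun s : ℝ => 1 / ((1 - s) * ∑' m, K.u e m * s ^ m)) (𝓝[<] 1) (𝓝 (1 / L e e)) :=
    tendsto_const_nhds.div (h.tendsto_one_sub_mul_tsum_u e) (h.pos e e).ne'
  have hpart : ∀ N, ∑ m ∈ range N, (m : ℝ) * K.phi e e m ≤ 1 / L e e := fun N => by
    have hpoly : Tendsto (fun s : ℝ => ∑ m ∈ range N, (m : ℝ) * K.phi e e m * s ^ m) (𝓝[<] 1)
        (𝓝 (∑ m ∈ range N, (m : ℝ) * K.phi e e m)) := by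
      have : Tendsto (fun s : ℝ => ∑ m ∈ range N, (m : ℝ) * K.phi e e m * s ^ m) (𝓝 1)
          (𝓝 (∑ m ∈ range N, (m : ℝ) * K.phi e e m * 1 ^ m)) :=
        tendsto_finsetSum _ fun m _ => ((continuous_pow m).tendsto 1).const_mul _
      simp only [one_pow, mul_one] at this
      exact this.mono_left nhdsWithin_le_nhds
    exact le_of_tendsto_of_tendsto hpoly hlimU (by filter_upwards [hIco] with s hs using hkey N s hs)
  exact summable_of_sum_range_le hnn hpart

/-! ### §6 Normalisation, aperiodicity transfer, and the Erdős–Feller–Pollard step -/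

omit h in
/-- `u(0) (1 − φ_e(0)) = 1` (the zero-length returns). [cite: Feller1968, XIII.3–4; lane «pcv-sawmu»] -/
theorem u_zero_mul : K.u e 0 * (1 - K.phi e e 0) = 1 := by
  have h0 := K.u_eq e 0
  rw [Finset.Nat.antidiagonal_zero, sum_singleton] at h0
  simp only [if_true] at h0
  linarith [h0]

omit h in
/-- `0 < 1 − φ_e(0)`. [cite: Feller1968, XIII.3–4; lane «pcv-sawmu»] -/
theorem one_sub_phi_zero_pos : 0 < 1 - K.phi e e 0 := by
  have h0 := K.u_zero_mul e
  have hu : 0 < K.u e 0 := lt_of_lt_of_le zero_lt_one (K.one_le_u_zero e)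
  by_contra hle
  have : K.u e 0 * (1 - K.phi e e 0) ≤ 0 := mul_nonpos_of_nonneg_of_nonpos hu.le (not_lt.1 hle)
  linarith

/-- The NORMALISED first-return law `f̃(k) = φ_e(k)/(1 − φ_e(0))` for `k ≥ 1`, `f̃(0) = 0`. [cite: Feller1968, XIII.3; lane] -/
def fN (k : ℕ) : ℝ := if k = 0 then 0 else K.phi e e k / (1 - K.phi e e 0)

/-- The NORMALISED renewal sequence `ṽ(n) = (1 − φ_e(0)) u(n)`. [cite: Feller1968, XIII.3; lane] -/
def vN (n : ℕ) : ℝ := (1 - K.phi e e 0) * K.u e n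

omit h in
/-- `f̃ ≥ 0`. [cite: Feller1968, XIII.3; lane plumbing] -/
theorem fN_nonneg (hpos : 0 < 1 - K.phi e e 0) (k : ℕ) : 0 ≤ K.fN e k := by
  rw [fN]; split_ifs
  · exact le_rfl
  · exact div_nonneg (K.phi_nonneg e e k) hpos.le

omit h in
/-- The first-return identity with the zero-length returns moved to the left:
`(1 − φ_e(0)) u(n) = Σ_{k<n} φ_e(k+1) u(n−1−k)` for `n ≥ 1`. [cite: Feller1968, XIII.3 (3.1); lane] -/
theorem one_sub_mul_u_eq {n : ℕ} (hn : n ≠ 0) :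
    (1 - K.phi e e 0) * K.u e n = ∑ k ∈ range n, K.phi e e (k + 1) * K.u e (n - (k + 1)) := by
  have h1 := K.u_eq e n
  rw [if_neg hn, zero_add, Nat.sum_antidiagonal_eq_sum_range_succ (fun i j => K.phi e e i * K.u e j), sum_range_succ'] at h1
  simp only [Nat.sub_zero] at h1
  linarith [h1]

omit h in
/-- The normalised renewal equation `ṽ(n) = Σ_{k ≤ n} f̃(k) ṽ(n−k)` (`n ≥ 1`). [cite: Feller1968, XIII.3 (3.1); MadrasSlade1993, (B.1); lane] -/
theorem vN_eq {n : ℕ} (hn : 1 ≤ n) : K.vN e n = ∑ k ∈ range (n + 1), K.fN e k * K.vN e (n - k) := by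
  have hpos := K.one_sub_phi_zero_pos e
  rw [sum_range_succ', vN, K.one_sub_mul_u_eq e (by omega)]
  simp only [fN, if_true, zero_mul, add_zero, Nat.succ_ne_zero, if_false, vN]
  refine sum_congr rfl fun k _ => ?_
  field_simp

omit h in
/-- `ṽ(0) = 1`. [cite: Feller1968, XIII.3; lane plumbing] -/
theorem vN_zero : K.vN e 0 = 1 := by
  rw [vN, mul_comm]; exact K.u_zero_mul e

/-- `Σ_k f̃(k) = 1`. [cite: Feller1968, XIII.3; lane] -/
theorem Critical.hasSum_fN : HasSum (K.fN e) 1 := by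
  have hpos := K.one_sub_phi_zero_pos e
  have h1 := (hasSum_nat_add_iff' 1).mpr (h.hasSum_phi_self e)
  simp only [sum_range_one] at h1
  have h2 : HasSum (fun k => K.phi e e (k + 1) / (1 - K.phi e e 0)) ((1 - K.phi e e 0) / (1 - K.phi e e 0)) :=
    h1.div_const _
  rw [div_self hpos.ne'] at h2
  refine (hasSum_nat_add_iff' 1).mp ?_
  simp only [sum_range_one, fN, if_true, sub_zero, Nat.succ_ne_zero, if_false]
  exact h2

/-- `0 ≤ ṽ ≤ 1`. [cite: Feller1968, XIII.3; lane] -/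
theorem Critical.vN_mem (n : ℕ) : 0 ≤ K.vN e n ∧ K.vN e n ≤ 1 := by
  have hpos := K.one_sub_phi_zero_pos e
  have hnn : ∀ n, 0 ≤ K.vN e n := fun n => mul_nonneg hpos.le (K.u_nonneg e n)
  refine ⟨hnn n, ?_⟩
  induction n using Nat.strong_induction_on with
  | _ n ih =>
    rcases Nat.eq_zero_or_pos n with rfl | hn
    · rw [K.vN_zero e]
    · rw [K.vN_eq e hn]
      calc ∑ k ∈ range (n + 1), K.fN e k * K.vN e (n - k) ≤ ∑ k ∈ range (n + 1), K.fN e k := by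
            refine sum_le_sum fun k hk => ?_
            rcases Nat.eq_zero_or_pos k with rfl | hk0
            · simp [fN]
            · exact mul_le_of_le_one_right (K.fN_nonneg e hpos k) (ih (n - k) (by omega))
        _ ≤ 1 := sum_le_hasSum _ (fun k _ => K.fN_nonneg e hpos k) (h.hasSum_fN e)

/-- `Σ_k k f̃(k) < ∞`. [cite: Feller1968, XIII.3–4; lane «pcv-sawmu»] -/
theorem Critical.summable_mul_fN : Summable fun k : ℕ => (k : ℝ) * K.fN e k := by
  have h1 := (h.summable_mul_phi_self e).div_const (1 - K.phi e e 0)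
  refine h1.congr fun k => ?_
  rcases Nat.eq_zero_or_pos k with rfl | hk
  · simp [fN]
  · rw [fN, if_neg (by omega)]; ring

/-- ★ APERIODICITY TRANSFER: the normalised first-return law at EVERY level `e` has `gcd {k : f̃(k) > 0} = 1`.
(From the gcd condition at `o` — through Mathlib's `Nat.exists_mem_closure_of_ge`, the positivity semigroup contains two consecutive
integers —, irreducibility and the positivity semigroup: `u(n₀) > 0` and `u(n₀+1) > 0` for some `n₀ ≥ 1`; and every
`n ≥ 1` with `u(n) > 0` is a sum of elements of the support of `f̃`.) [cite: Feller1968, XIII.3 (periodic / aperiodic events); lane] -/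
theorem Critical.setGcd_fN : Nat.setGcd {k : ℕ | 0 < K.fN e k} = 1 := by
  have hpos := K.one_sub_phi_zero_pos e
  set g := Nat.setGcd {k : ℕ | 0 < K.fN e k} with hg
  -- every `n ≥ 1` with `u(n) > 0` is divisible by `g`
  have hdiv : ∀ n, 1 ≤ n → 0 < K.u e n → g ∣ n := by
    intro n
    induction n using Nat.strong_induction_on with
    | _ n ih =>
      intro hn hu
      have h1 := K.one_sub_mul_u_eq e (show n ≠ 0 by omega)
      have hsum : 0 < ∑ k ∈ range n, K.phi e e (k + 1) * K.u e (n - (k + 1)) := by rw [← h1]; exact mul_pos hpos hu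
      obtain ⟨k, hk, hterm⟩ : ∃ k ∈ range n, 0 < K.phi e e (k + 1) * K.u e (n - (k + 1)) := by
        by_contra hne
        rw [not_exists] at hne
        have : ∑ k ∈ range n, K.phi e e (k + 1) * K.u e (n - (k + 1)) ≤ 0 :=
          sum_nonpos fun k hk => not_lt.1 fun hh => hne k ⟨hk, hh⟩
        linarith
      have hk' : k + 1 ≤ n := by have := mem_range.1 hk; omega
      have hφ : 0 < K.phi e e (k + 1) := by
        rcases (K.phi_nonneg e e (k + 1)).eq_or_lt with h0 | h0
        · rw [← h0, zero_mul] at hterm; exact absurd hterm (lt_irrefl _)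
        · exact h0
      have hu' : 0 < K.u e (n - (k + 1)) := by
        rcases (K.u_nonneg e (n - (k + 1))).eq_or_lt with h0 | h0
        · rw [← h0, mul_zero] at hterm; exact absurd hterm (lt_irrefl _)
        · exact h0
      have hgk : g ∣ k + 1 := by
        refine Nat.setGcd_dvd_of_mem ?_
        show 0 < K.fN e (k + 1)
        rw [fN, if_neg (Nat.succ_ne_zero k)]
        exact div_pos hφ hpos
      rcases Nat.eq_or_lt_of_le hk' with heq | hlt
      · rw [← heq]; exact hgk
      · have hrest : g ∣ n - (k + 1) := ih _ (by omega) (by omega) hu'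
        have := Nat.dvd_add hgk hrest
        rwa [Nat.add_sub_cancel' hk'] at this
  -- two consecutive elements of the positivity semigroup at the aperiodic level `o`
  obtain ⟨o, ho⟩ := h.aper
  have hclos : ∀ m ∈ AddSubmonoid.closure {m : ℕ | 0 < K.D m o o}, K.Pos m o o := fun m hm => by
    refine AddSubmonoid.closure_induction (fun n hn => ?_) ?_ (fun x y _ _ hx hy => hx.add hy) hm
    · exact (K.pos_iff n o o).2 (lt_of_lt_of_le hn (K.D_le_G n o o))
    · exact (K.pos_iff 0 o o).2 (lt_of_lt_of_le zero_lt_one (K.one_le_G_zero o))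
  obtain ⟨q, hq⟩ := Nat.exists_mem_closure_of_ge {m : ℕ | 0 < K.D m o o}
  have hoq : K.Pos q o o := hclos q (hq q le_rfl (by rw [ho]; exact one_dvd _))
  have hoq1 : K.Pos (q + 1) o o := hclos (q + 1) (hq (q + 1) (by omega) (by rw [ho]; exact one_dvd _))
  obtain ⟨m₁, h₁⟩ := h.exists_pos e o
  obtain ⟨m₂, h₂⟩ := h.exists_pos o e
  have hA : K.Pos (m₁ + q + m₂) e e := (h₁.add hoq).add h₂
  have hB : K.Pos (m₁ + q + m₂ + 1) e e := by
    have := (h₁.add hoq1).add h₂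
    have heq : m₁ + (q + 1) + m₂ = m₁ + q + m₂ + 1 := by omega
    rwa [heq] at this
  have huB : 0 < K.u e (m₁ + q + m₂ + 1) := (K.pos_iff _ e e).1 hB
  have hgB := hdiv _ (by omega) huB
  rcases Nat.eq_zero_or_pos (m₁ + q + m₂) with h0 | hpos
  · rw [h0, zero_add] at hgB
    exact Nat.dvd_one.mp hgB
  · have huA : 0 < K.u e (m₁ + q + m₂) := (K.pos_iff _ e e).1 hA
    have hgA := hdiv _ hpos huA
    exact Nat.dvd_one.mp ((Nat.dvd_add_right hgA).mp hgB)

/-- ★ The Erdős–Feller–Pollard step at the level `e`: `u(m) → Λ_e := (Σ_k k f̃(k))⁻¹ / (1 − φ_e(0))`.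
[cite: Feller1968, XIII.11; MadrasSlade1993, Theorem 4.2.2 (b); tree `Renewal.tendsto_of_summable_mul_of_setGcd`] -/
theorem Critical.tendsto_u :
    Tendsto (K.u e) atTop (𝓝 ((∑' k : ℕ, (k : ℝ) * K.fN e k)⁻¹ / (1 - K.phi e e 0))) := by
  have hpos := K.one_sub_phi_zero_pos e
  have hv := Renewal.tendsto_of_summable_mul_of_setGcd (u := K.vN e) (f := K.fN e) (K.vN_zero e)
    (fun n => (h.vN_mem e n).1) (fun n => (h.vN_mem e n).2) (K.fN_nonneg e hpos) (by simp [fN])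
    (fun n hn => K.vN_eq e hn) (h.hasSum_fN e) (h.setGcd_fN e) (h.summable_mul_fN e)
  have h2 := hv.div_const (1 - K.phi e e 0)
  refine h2.congr fun n => ?_
  rw [vN]; field_simp

/-- `Λ_e > 0`. [cite: Feller1968, XIII.3–4; lane «pcv-sawmu»] -/
theorem Critical.lim_pos : 0 < (∑' k : ℕ, (k : ℝ) * K.fN e k)⁻¹ / (1 - K.phi e e 0) := by
  have hpos := K.one_sub_phi_zero_pos e
  refine div_pos (inv_pos.2 ?_) hpos
  have h1 : (1 : ℝ) ≤ ∑' k : ℕ, (k : ℝ) * K.fN e k := by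
    rw [← (h.hasSum_fN e).tsum_eq]
    refine (h.hasSum_fN e).summable.tsum_le_tsum (fun k => ?_) (h.summable_mul_fN e)
    rcases Nat.eq_zero_or_pos k with rfl | hk
    · simp [fN]
    · exact le_mul_of_one_le_left (K.fN_nonneg e hpos k) (by exact_mod_cast hk)
  linarith

/-- ★ IDENTIFICATION OF THE LIMIT by the Abelian hypothesis: `Λ_e = L_{ee}`. [cite: Feller1971, XIII.5 Theorem 5 (easy half); lane] -/
theorem Critical.lim_eq : (∑' k : ℕ, (k : ℝ) * K.fN e k)⁻¹ / (1 - K.phi e e 0) = L e e := by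
  set Λ := (∑' k : ℕ, (k : ℝ) * K.fN e k)⁻¹ / (1 - K.phi e e 0)
  have hD : Tendsto (fun m => K.D m e e) atTop (𝓝 Λ) := by
    refine (h.tendsto_u e).congr' ?_
    filter_upwards [eventually_ge_atTop 1] with m hm
    rw [u, K.G_eq_D (by omega)]
  have hA := tendsto_one_sub_mul_tsum_of_tendsto (fun m => K.D_nonneg m e e) (h.lim_pos e) hD
  exact tendsto_nhds_unique hA (h.abel e e)

/-- ★★ **The renewal constant is the reciprocal mean return length** (Feller's `u_n → 1/μ`): at every level `e`,
`L_{ee} = 1 / Σ_m m·φ_e(m)` — the Abelian limit on the diagonal equals the reciprocal of the mean length of a first return to `e`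
(zero-length returns included in the law `φ_e`, `Σ_m φ_e(m) = 1`). [cite: Feller1968, XIII.3 Theorem 3 / XIII.11 (u_n → 1/μ); lane «pcv-sawmu» — matrix form] -/
theorem Critical.eq_inv_tsum_mul_phi : L e e = (∑' m : ℕ, (m : ℝ) * K.phi e e m)⁻¹ := by
  have hpos := K.one_sub_phi_zero_pos e
  have h1 : ∑' k : ℕ, (k : ℝ) * K.fN e k = (∑' m : ℕ, (m : ℝ) * K.phi e e m) / (1 - K.phi e e 0) := by
    rw [← tsum_div_const]
    refine tsum_congr fun k => ?_
    rcases Nat.eq_zero_or_pos k with rfl | hk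
    · simp [fN]
    · rw [fN, if_neg (by omega)]; ring
  rw [← h.lim_eq e, h1, inv_div, div_div, div_mul_cancel_right₀ hpos.ne']

/-- ★ The diagonal case: `D(m)_{ee} → L_{ee}`. [cite: Feller1968, XIII.3–4; lane «pcv-sawmu»] -/
theorem Critical.tendsto_D_self : Tendsto (fun m => K.D m e e) atTop (𝓝 (L e e)) := by
  rw [← h.lim_eq e]
  refine (h.tendsto_u e).congr' ?_
  filter_upwards [eventually_ge_atTop 1] with m hm
  rw [u, K.G_eq_D (by omega)]

/-- ★ The off-diagonal case (delayed renewal): for `c ≠ e`, `D(m)_{ce} → (L_{ce}/L_{ee}) · L_{ee} = L_{ce}`.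
[cite: MadrasSlade1993, Theorem 4.2.2 (b); tree `Renewal.tendsto_sum_antidiagonal_mul`; lane] -/
theorem Critical.tendsto_D_col {c : ι} (hc : c ≠ e) : Tendsto (fun m => K.D m c e) atTop (𝓝 (L c e)) := by
  have hpos := K.one_sub_phi_zero_pos e
  have hB : ∀ n, |K.u e n| ≤ 1 / (1 - K.phi e e 0) := fun n => by
    rw [abs_of_nonneg (K.u_nonneg e n), le_div_iff₀ hpos, mul_comm]
    exact (h.vN_mem e n).2
  have hu : Tendsto (K.u e) atTop (𝓝 (L e e)) := by rw [← h.lim_eq e]; exact h.tendsto_u e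
  have hconv := Renewal.tendsto_sum_antidiagonal_mul (K.phi_nonneg e c) (h.hasSum_phi e hc).summable hB hu
  rw [(h.hasSum_phi e hc).tsum_eq, div_mul_cancel₀ _ (h.pos e e).ne'] at hconv
  exact hconv.congr fun m => (K.D_col_eq e hc m).symm

end Critical

/-! ### §7 The theorem -/

/-- ★★★ **THE COEFFICIENT RENEWAL THEOREM FOR MATRIX RENEWAL SEQUENCES (finite state space, critical point).**  Let
`D(m) = M(m) + Σ_{i+j=m} M(i) D(j)` with `M, D ≥ 0` on a finite level set; assume `Σ_m D(m)_{ab} s^m < ∞` on `[0,1)`, the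
Abelian limits `(1 − s) Σ_m D(m)_{ab} s^m → L_{ab} > 0` (`s ↑ 1`), a finite first moment `Σ_j j M(j)_{ab} < ∞`, and `gcd {m : D(m)_{oo} > 0} = 1`
at one level `o`.  Then for ALL levels `a, b`: `D(m)_{ab} ⟶ L_{ab}` as `m → ∞`.
[cite: Feller1968, XIII.3–4, XIII.11 (recurrent events, renewal theorem, delayed events); MadrasSlade1993, Theorem 4.2.2 (b); Feller1971, XIII.5 Theorem 5; lane «pcv-sawmu», a-p2 g19 — own arrangement (taboo resolvent + aperiodicity transfer + Abelian identification)] -/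
theorem tendsto_coeff {L : ι → ι → ℝ} (h : K.Critical L) (a b : ι) : Tendsto (fun m => K.D m a b) atTop (𝓝 (L a b)) := by
  by_cases hab : a = b
  · subst hab; exact h.tendsto_D_self a
  · exact h.tendsto_D_col b hab

end RenewalKernelPair

end Literature.Probability.Process
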